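import Summits.CriticalPhenomena.PercolationContinuityZ3.Theorems.Transplant.SubdivisionGrowth
import Summits.CriticalPhenomena.PercolationContinuityZ3.Theorems.Transplant.SiteBurtonKeaneQT
import Summits.CriticalPhenomena.PercolationContinuityZ3.Theorems.Transplant.LineGraphSiteScope
import Summits.CriticalPhenomena.PercolationContinuityZ3.Theorems.Transplant.KagomeSiteCritical
import Summits.CriticalPhenomena.PercolationContinuityZ3.Theorems.Transplant.ThetaContinuousStacks
import Literature.Probability.LatticeModels.TriangularLatticeProofs
import Summits.CriticalPhenomena.PercolationContinuityZ3.Theorems.Transplant.CubicLatticesAmenable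
import HarnessLib

/-!
# Line graphs (covering lattices) inherit polynomial growth; site uniqueness on the covering lattice of `ℤ^d` and on the `(3,12²)` tiling

builds on p205010 (kernel theorem, internal audit signed; external expert review pending) — NOT used in this file.
Lane `prim-bschramm`, seat `prim-bschramm-p2` gen 17 (class C1b); helper file (`--supports stmt-CriticalPhenomena-4575 --as helper`).
Continues `SubdivisionGrowth` (edge nets) with the second classical lattice transformation of gen 13, the COVERING LATTICE `L(G)`
(Mathlib `SimpleGraph.lineGraph`; site percolation on `L(G)` ≡ bond percolation on `G`, Fisher–Essam / Kesten).

* §1 `exists_walk_of_lineGraph_walk` — a walk `e = e₀, e₁, …, e_k` of `L(G)` gives, from any endpoint of `e₀`, a walk of `G` of length `≤ k`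
  to an endpoint of `e_k` (consecutive bonds share a site); `graphBall_lineGraph_subset`; **`ballVolume_lineGraph_le`**:
  `|B_{L(G)}(e, n)| ≤ |B_G(a, n)| · Δ` (`a ∈ e`, `Δ` a degree bound); **`not_hasExponentialGrowth_lineGraph`**;
* §2 the covering lattice of `ℤ^d` (`d = 2`: Kesten's `G₁`): amenable, **`zdLineGraph_site_uniqueness`** (a.s. at most one infinite open SITE
  cluster, every `d ≥ 1`, every `p`; site Burton–Keane `sitePercolation_ae_unique_infinite_siteCluster_of_isGraphAmenable`);
* §3 the `(3,12²)` tiling `L(honeycomb^∘)`: `ballVolume_subdiv_le_poly` (polynomial bound for edge nets), amenable,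
  **`threeTwelve_site_uniqueness`**.
[cite: BurtonKeane1989, Thm. 2] [cite: Haggstrom2011, Thm. 2.6] [cite: BenjaminiSchramm1996, §4 (after Conj. 5)] [cite: Kesten1982, §2.5 Comment (iii)]
[cite: LyonsPeres2016, §6.1] -/

noncomputable section

namespace Summit.CriticalPhenomena.PercolationContinuityZ3.Theorems.Transplant

namespace LineGraphGrowth

open MeasureTheory Literature.Probability.Percolation Literature.Probability.LatticeModels SimpleGraph Filter
open Literature.Barriers.CriticalPhenomena Literature.MathematicalPhysics.QuantumLattice Subdiv SubdivGrowth SiteUniqQT ThetaContStacks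
open scoped Classical Topology

variable {V : Type} {G : SimpleGraph V}

/-! ## §1 Walks of the line graph project to walks of the graph -/

/-- **A walk of `L(G)` projects to a walk of `G`**: from any endpoint `a` of its first bond there is a walk of `G`, not longer than it, to an
endpoint of its last bond. [cite: Kesten1982, §2.5 Comment (iii)] -/
theorem exists_walk_of_lineGraph_walk {e f : G.edgeSet} (w : G.lineGraph.Walk e f) :
    ∀ a ∈ (e : Sym2 V), ∃ b ∈ (f : Sym2 V), ∃ w' : G.Walk a b, w'.length ≤ w.length := by
  induction w with
  | nil => intro a ha; exact ⟨a, ha, Walk.nil, le_rfl⟩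
  | @cons e e₁ f h p ih =>
    intro a ha
    obtain ⟨-, c, hce, hce₁⟩ := lineGraph_adj_iff_exists.1 h
    have step : ∃ w₁ : G.Walk a c, w₁.length ≤ 1 := by
      by_cases hac : a = c
      · subst hac; exact ⟨Walk.nil, by simp⟩
      · exact ⟨Walk.cons (adj_of_mem_of_mem ha hce hac) Walk.nil, by simp⟩
    obtain ⟨w₁, hw₁⟩ := step
    obtain ⟨b, hb, w₂, hw₂⟩ := ih c hce₁
    exact ⟨b, hb, w₁.append w₂, by rw [Walk.length_append, Walk.length_cons]; omega⟩

/-- **The ball of the line graph**: `B_{L(G)}(e, n) ⊆ {bonds meeting B_G(a, n)}` for any endpoint `a` of `e`. [folklore] -/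
theorem graphBall_lineGraph_subset (e : G.edgeSet) {a : V} (ha : a ∈ (e : Sym2 V)) (n : ℕ) :
    graphBall G.lineGraph e n ⊆ {f : G.edgeSet | ∃ b ∈ graphBall G a n, b ∈ (f : Sym2 V)} := by
  rintro f ⟨w, hw⟩
  obtain ⟨b, hb, w', hw'⟩ := exists_walk_of_lineGraph_walk w a ha
  exact ⟨b, ⟨w', hw'.trans hw⟩, hb⟩

section Volume

variable [DecidableEq V] [G.LocallyFinite]

/-- **`|B_{L(G)}(e, n)| ≤ |B_G(a, n)| · Δ`** (`a ∈ e`, `Δ` a degree bound of `G`). [cite: LyonsPeres2016, §6.1] -/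
theorem ballVolume_lineGraph_le {Δ : ℕ} (hΔ : ∀ v, G.degree v ≤ Δ) (e : G.edgeSet) {a : V} (ha : a ∈ (e : Sym2 V)) (n : ℕ) :
    ballVolume G.lineGraph e n ≤ ballVolume G a n * Δ := by
  have hB : (graphBall G a n).Finite := graphBall_finite G a n
  unfold ballVolume
  exact (Set.ncard_le_ncard (graphBall_lineGraph_subset e ha n) (edges_meeting_finite hB)).trans (ncard_edges_meeting_le hB hΔ)

/-- **The line graph of a graph of polynomial growth and bounded degree has no exponential growth.** [cite: LyonsPeres2016, §6.1] -/
theorem not_hasExponentialGrowth_lineGraph {Δ : ℕ} (hΔ : ∀ v, G.degree v ≤ Δ) {C : ℝ} {D : ℕ}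
    (hpoly : ∀ (y : V) (n : ℕ), (ballVolume G y n : ℝ) ≤ C * ((n : ℝ) + 1) ^ D) (e₀ : G.edgeSet) : ¬ HasExponentialGrowth G.lineGraph := by
  refine not_hasExponentialGrowth_of_polynomialGrowth G.lineGraph e₀ ⟨C * Δ, D, fun f n => ?_⟩
  rw [Real.rpow_natCast]
  have h1 : (ballVolume G.lineGraph f n : ℝ) ≤ ballVolume G (endpt f 0) n * Δ := by
    exact_mod_cast ballVolume_lineGraph_le hΔ f (endpt_mem f 0) n
  have h2 := hpoly (endpt f 0) n
  have hΔ0 : (0 : ℝ) ≤ Δ := by positivity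
  calc (ballVolume G.lineGraph f n : ℝ) ≤ ballVolume G (endpt f 0) n * Δ := h1
    _ ≤ C * ((n : ℝ) + 1) ^ D * Δ := by gcongr
    _ = C * Δ * ((n : ℝ) + 1) ^ D := by ring

/-- **A polynomial volume bound for the edge net** from one for the graph (`|B_{G^∘}(u, n)| ≤ C(1+Δ)2^D (n+1)^D`). [cite: LyonsPeres2016, §6.1] -/
theorem ballVolume_subdiv_le_poly {Δ : ℕ} (hΔ : ∀ v, G.degree v ≤ Δ) {C : ℝ} {D : ℕ}
    (hpoly : ∀ (y : V) (n : ℕ), (ballVolume G y n : ℝ) ≤ C * ((n : ℝ) + 1) ^ D) (u : V ⊕ G.edgeSet) (n : ℕ) :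
    (ballVolume (subdiv G) u n : ℝ) ≤ C * (1 + Δ) * 2 ^ D * ((n : ℝ) + 1) ^ D := by
  have hn1 : (0 : ℝ) ≤ (n : ℝ) + 1 := by positivity
  have hΔ0 : (0 : ℝ) ≤ 1 + Δ := by positivity
  cases u with
  | inl y =>
    have hC : 0 ≤ C := by
      have h := hpoly y 0
      simp only [Nat.cast_zero, zero_add, one_pow, mul_one] at h
      exact le_trans (Nat.cast_nonneg _) h
    have h1 : (ballVolume (subdiv G) (Sum.inl y) n : ℝ) ≤ ballVolume G y n * (1 + Δ) := by exact_mod_cast ballVolume_subdiv_inl_le hΔ y n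
    have h2 := hpoly y n
    have hpow : ((n : ℝ) + 1) ^ D ≤ (2 : ℝ) ^ D * ((n : ℝ) + 1) ^ D := by
      have : (1 : ℝ) ≤ (2 : ℝ) ^ D := one_le_pow₀ (by norm_num)
      nlinarith [pow_nonneg hn1 D]
    calc (ballVolume (subdiv G) (Sum.inl y) n : ℝ) ≤ ballVolume G y n * (1 + Δ) := h1
      _ ≤ C * ((n : ℝ) + 1) ^ D * (1 + Δ) := by gcongr
      _ ≤ C * (1 + Δ) * 2 ^ D * ((n : ℝ) + 1) ^ D := by nlinarith [mul_nonneg hC hΔ0]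
  | inr e =>
    have hC : 0 ≤ C := by
      have h := hpoly (endpt e 0) 0
      simp only [Nat.cast_zero, zero_add, one_pow, mul_one] at h
      exact le_trans (Nat.cast_nonneg _) h
    have h1 : (ballVolume (subdiv G) (Sum.inr e) n : ℝ) ≤ ballVolume G (endpt e 0) (n + 1) * (1 + Δ) := by
      exact_mod_cast ballVolume_subdiv_inr_le hΔ e n
    have h2 := hpoly (endpt e 0) (n + 1)
    have hpow2 : (((n + 1 : ℕ) : ℝ) + 1) ^ D ≤ (2 : ℝ) ^ D * ((n : ℝ) + 1) ^ D := by
      rw [← mul_pow]; exact pow_le_pow_left₀ (by positivity) (by push_cast; linarith) D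
    calc (ballVolume (subdiv G) (Sum.inr e) n : ℝ) ≤ ballVolume G (endpt e 0) (n + 1) * (1 + Δ) := h1
      _ ≤ C * (((n + 1 : ℕ) : ℝ) + 1) ^ D * (1 + Δ) := by gcongr
      _ ≤ C * (2 ^ D * ((n : ℝ) + 1) ^ D) * (1 + Δ) := by gcongr
      _ = C * (1 + Δ) * 2 ^ D * ((n : ℝ) + 1) ^ D := by ring

end Volume

/-! ## §2 The covering lattice of `ℤ^d` -/

/-- A bond of `ℤ^d` (`d ≥ 1`). [folklore] -/
def zdEdge₀ (d : ℕ) [NeZero d] : (zdGraph d).edgeSet :=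
  ⟨s((0 : Site d), (0 : Site d) + Pi.single 0 1), (zdGraph_adj_iff _ _).2 ⟨0, Or.inl rfl⟩⟩

/-- **The covering lattice of `ℤ^d` has no exponential growth.** [cite: LyonsPeres2016, §6.1] -/
theorem zdLineGraph_not_hasExponentialGrowth (d : ℕ) [NeZero d] : ¬ HasExponentialGrowth (zdGraph d).lineGraph := by
  obtain ⟨Δ, hΔ⟩ := (zdGraph_isQuasiTransitive d).exists_degree_le
  refine not_hasExponentialGrowth_lineGraph hΔ (C := (2 : ℝ) ^ d) (D := d) (fun y n => ?_) (zdEdge₀ d)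
  have h : (ballVolume (zdGraph d) y n : ℝ) ≤ (2 * n + 1 : ℝ) ^ d := by
    exact_mod_cast ThetaCont.ballVolume_le_of_le_zdGraph (le_refl _) y n
  refine h.trans ?_
  rw [← mul_pow]
  exact pow_le_pow_left₀ (by positivity) (by linarith) d

/-- **Uniqueness of the infinite open SITE cluster on the covering lattice of `ℤ^d`, every `d ≥ 1`, every `p`** (site Burton–Keane on the
connected, quasi-transitive, AMENABLE line graph). [cite: BurtonKeane1989, Thm. 2] [cite: Haggstrom2011, Thm. 2.6] -/
theorem zdLineGraph_site_uniqueness (d : ℕ) [NeZero d] (p : unitInterval) :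
    ∀ᵐ σ ∂(sitePercolation (zdGraph d).edgeSet p), ∀ x y, (siteCluster (zdGraph d).lineGraph σ x).Infinite →
      (siteCluster (zdGraph d).lineGraph σ y).Infinite → (siteOpenGraph (zdGraph d).lineGraph σ).Reachable x y := by
  haveI : (zdGraph d).lineGraph.LocallyFinite := nonempty_lineGraph_locallyFinite.some
  have hq : IsQuasiTransitive (zdGraph d).lineGraph := lineGraph_isQuasiTransitive (zdGraph_isQuasiTransitive d)
  have ha : IsGraphAmenable (zdGraph d).lineGraph := by
    by_contra h
    exact zdLineGraph_not_hasExponentialGrowth d (hasExponentialGrowth_of_not_isGraphAmenable _ hq h)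
  exact sitePercolation_ae_unique_infinite_siteCluster_of_isGraphAmenable (lineGraph_connected (zdGraph_connected d) (zdEdge₀ d)) hq ha p

/-- **Uniqueness of the infinite open BOND cluster on the covering lattice of `ℤ^d`, every `p`** (Burton–Keane). [cite: BurtonKeane1989, Thm. 2] -/
theorem zdLineGraph_bond_uniqueness (d : ℕ) [NeZero d] (p : unitInterval) :
    ∀ᵐ ω ∂bondPercolation (zdGraph d).lineGraph p, numInfiniteClusters ω ≤ 1 := by
  haveI : (zdGraph d).lineGraph.LocallyFinite := nonempty_lineGraph_locallyFinite.some
  have hq : IsQuasiTransitive (zdGraph d).lineGraph := lineGraph_isQuasiTransitive (zdGraph_isQuasiTransitive d)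
  have ha : IsGraphAmenable (zdGraph d).lineGraph := by
    by_contra h
    exact zdLineGraph_not_hasExponentialGrowth d (hasExponentialGrowth_of_not_isGraphAmenable _ hq h)
  exact BurtonKeane1989_atMostOneInfiniteCluster_holds _ (lineGraph_connected (zdGraph_connected d) (zdEdge₀ d)) hq ha p

/-! ## §3 The `(3,12²)` tiling `L(honeycomb^∘)` -/

/-- **The `(3,12²)` tiling has no exponential growth** (honeycomb quadratic growth ⇒ its edge net ⇒ the line graph). [cite: LyonsPeres2016, §6.1] -/
theorem threeTwelve_not_hasExponentialGrowth : ¬ HasExponentialGrowth (subdiv hexGraph).lineGraph := by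
  haveI : (subdiv hexGraph).LocallyFinite := nonempty_subdiv_locallyFinite.some
  obtain ⟨Δ, hΔ⟩ := honeycomb_conj4_hypotheses.2.1.exists_degree_le
  obtain ⟨Δ', hΔ'⟩ := (subdiv_isQuasiTransitive honeycomb_conj4_hypotheses.2.1).exists_degree_le
  have hhex : ∀ (y : HexVertex) (n : ℕ), (ballVolume hexGraph y n : ℝ) ≤ (8 : ℝ) * ((n : ℝ) + 1) ^ 2 := by
    intro y n
    have h : (ballVolume hexGraph y n : ℝ) ≤ (2 * n + 1 : ℝ) ^ 2 * 2 := by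
      have := ballVolume_le_of_cellLipschitz hexGraph hexGraph_cellLipschitz y n
      simp only [Fintype.card_fin] at this
      exact_mod_cast this
    have key : (2 * (n : ℝ) + 1) ^ 2 * 2 ≤ 8 * ((n : ℝ) + 1) ^ 2 := by nlinarith [Nat.cast_nonneg (α := ℝ) n]
    linarith
  have e₀ : (subdiv hexGraph).edgeSet :=
    ⟨s(Sum.inl ((0 : Site 2), (0 : Fin 2)), Sum.inr ⟨s(((0 : Site 2), (0 : Fin 2)), ((0 : Site 2), (1 : Fin 2))), (hexGraph_adj_iff_of_snd_eq_zero_holds 0 0).2 (Or.inl rfl)⟩),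
      subdiv_adj_inl_inr.2 (Sym2.mem_mk_left _ _)⟩
  exact not_hasExponentialGrowth_lineGraph hΔ' (C := 8 * (1 + Δ) * 2 ^ 2) (D := 2) (ballVolume_subdiv_le_poly hΔ hhex) e₀

/-- **Uniqueness of the infinite open SITE cluster on the `(3,12²)` tiling, every `p`** (site Burton–Keane; amenable by §3).
[cite: BurtonKeane1989, Thm. 2] [cite: Haggstrom2011, Thm. 2.6] -/
theorem threeTwelve_site_uniqueness (p : unitInterval) :
    ∀ᵐ σ ∂(sitePercolation (subdiv hexGraph).edgeSet p), ∀ x y, (siteCluster (subdiv hexGraph).lineGraph σ x).Infinite →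
      (siteCluster (subdiv hexGraph).lineGraph σ y).Infinite → (siteOpenGraph (subdiv hexGraph).lineGraph σ).Reachable x y := by
  haveI : (subdiv hexGraph).LocallyFinite := nonempty_subdiv_locallyFinite.some
  haveI : (subdiv hexGraph).lineGraph.LocallyFinite := nonempty_lineGraph_locallyFinite.some
  obtain ⟨hconn, hqt, -⟩ := threeTwelve_site_conj4_hypotheses
  have ha : IsGraphAmenable (subdiv hexGraph).lineGraph := by
    by_contra h
    exact threeTwelve_not_hasExponentialGrowth (hasExponentialGrowth_of_not_isGraphAmenable _ hqt h)
  exact sitePercolation_ae_unique_infinite_siteCluster_of_isGraphAmenable hconn hqt ha p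

/-! ## §4 Covering lattices of the cubic-system lattices (generic form) -/

/-- **Site uniqueness on the covering lattice `L(G)` of any connected quasi-transitive `G = (distSqGraph d m).induce S`, `m < 4`**
(fcc, bcc, diamond, simple cubic, …; an edge `e₀` witnesses non-emptiness): the line graph has polynomial growth
(`ballVolume_distSqGraph_induce_le` + `not_hasExponentialGrowth_lineGraph`), hence is amenable, and site Burton–Keane applies.
[cite: BurtonKeane1989, Thm. 2] [cite: Haggstrom2011, Thm. 2.6] [cite: LyonsPeres2016, §6.1] -/
theorem distSqGraph_induce_lineGraph_site_uniqueness {d : ℕ} {m : ℤ} (hm : m < 4) (S : Set (Site d))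
    [((distSqGraph d m).induce S).LocallyFinite] (hc : ((distSqGraph d m).induce S).Connected)
    (hq : IsQuasiTransitive ((distSqGraph d m).induce S)) (e₀ : ((distSqGraph d m).induce S).edgeSet) (p : unitInterval) :
    ∀ᵐ σ ∂(sitePercolation ((distSqGraph d m).induce S).edgeSet p), ∀ e f,
      (siteCluster ((distSqGraph d m).induce S).lineGraph σ e).Infinite → (siteCluster ((distSqGraph d m).induce S).lineGraph σ f).Infinite →
        (siteOpenGraph ((distSqGraph d m).induce S).lineGraph σ).Reachable e f := by
  haveI : ((distSqGraph d m).induce S).lineGraph.LocallyFinite := nonempty_lineGraph_locallyFinite.some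
  obtain ⟨Δ, hΔ⟩ := hq.exists_degree_le
  have hpoly : ∀ (y : S) (n : ℕ), (ballVolume ((distSqGraph d m).induce S) y n : ℝ) ≤ (2 : ℝ) ^ d * ((n : ℝ) + 1) ^ d := by
    intro y n
    have h : (ballVolume ((distSqGraph d m).induce S) y n : ℝ) ≤ (2 * n + 1 : ℝ) ^ d := by
      exact_mod_cast ballVolume_distSqGraph_induce_le hm S y n
    refine h.trans ?_
    rw [← mul_pow]
    exact pow_le_pow_left₀ (by positivity) (by linarith) d
  have hq' : IsQuasiTransitive ((distSqGraph d m).induce S).lineGraph := lineGraph_isQuasiTransitive hq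
  have ha : IsGraphAmenable ((distSqGraph d m).induce S).lineGraph := by
    by_contra h
    exact not_hasExponentialGrowth_lineGraph hΔ hpoly e₀ (hasExponentialGrowth_of_not_isGraphAmenable _ hq' h)
  exact sitePercolation_ae_unique_infinite_siteCluster_of_isGraphAmenable (lineGraph_connected hc e₀) hq' ha p

end LineGraphGrowth

end Summit.CriticalPhenomena.PercolationContinuityZ3.Theorems.Transplant

end
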